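import Literature.NumberTheory.LFunctions.Zhang2022.KnifeEdgeLenZDegreeAtoms

/-!
# Zhang (2022), rung F-S3 (Landau–Siegel programme, §D edge len = E*-len⁺): route `ZDegreeToeplitzBand`, item α1 —
# HONEST INTEGRALS for the reflected and two-variable closed-form atoms (critic's debt D1), and kernel-continuity facts

Y. Zhang, *Discrete mean estimates and the Landau–Siegel zero*, arXiv:2211.02515v1 [Zhang2022LandauSiegel] — an
unrefereed manuscript under adjudication. **WHAT THIS IS NOT: not a claim about Theorems 1–2 of arXiv:2211.02515, about
Landau–Siegel zeros, or about Parity. The programme SEARCHES and TYPES; no claim about Landau–Siegel zeros, Theorems 1–2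
of arXiv:2211.02515 or a repaired Margin232 until a kernel theorem says so.** No table of the route is defined or asserted
here and NO instance of `KnifeEdge.PsiGradedClosedForms` is constructed (the file is `E₀`-free): it discharges, for the atom
vocabulary of `KnifeEdgeLenZDegreeAtoms` (p508331/p510379, typer ls-knife-typer-1 g6), the integrability debt the critic
ls-knife-crit-1 booked at C1 CONFIRM — SCHEMA (2026-08-27T07:30:56Z, ask D1, pin (b″) «no silent-zero integrals»): the
honest-integral lemmas for the reflected atom `antiloc` and the two-variable atoms `bulk` (= `kernelPair 1 1`) and `volt`,
which p510379 left open (`loc`, `intPt`, `ptInt` were done there).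

* Part 1 — the reflection `y ↦ 1 − y` of `[0,1]`: it preserves Lebesgue measure restricted to `(0,1]` (up to the null
  endpoints), so an `L²` derivative leg stays `L²` after reflection (`memLp_comp_one_sub_unit`), and an `H¹` profile
  `(g, g′)` reflects to the `H¹` profile `(g(1−·), −g′(1−·))` (`IsH1OnUnitInterval.reflect` — the tree's absolutely-continuous
  bookkeeping `g(y) = g(0) + ∫₀ʸ g′`, transported by `∫₀ʸ g′(1−t) dt = ∫_{1−y}^1 g′`). A KINKED profile (right derivatives)
  reflects to a profile with LEFT derivatives, so the reflected leg is handled at the `H¹` level, which is all the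
  integrability lemmas use.
* Part 2 — `intervalIntegrable_antilocalPair_integrand`: the integrand of `antilocalPair k₀₀ k₀₁ k₁₀ k₁₁` is integrable on
  `[0,1]` for kernels continuous on `[0,1]` and kinked legs (`C⁰·C⁰`, `C⁰·L²`, `L²·L²` exactly as for `localPair`, with the
  second leg reflected).
* Part 3 — parametric integrals against a kernel continuous on the CLOSED square: for `h ∈ L¹[0,1]`,
  `x ↦ ∫₀¹ K(x,y) h(y) dy` and the Volterra primitive `x ↦ ∫₀ˣ K(x,y) h(y) dy` are continuous on `[0,1]` (dominated
  convergence with the bound `‖K‖_∞·|h|`; for the primitive the integrand `𝟙_{y ≤ x} K(x,y) h(y)` is continuous in `x` off the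
  null set `{y = x₀}`).
* (Sibling leaf `KnifeEdgeLenZDegreeAtomsBulkVolt`, split for the 400-line cap) — the honest integrals for `bulk`/`volt`:
  inner integrability for every `x ∈ [0,1]`, the split `f(x)·I₀₀(x) + f(x)·I₀₁(x) + f′(x)·I₁₀(x) + f′(x)·I₁₁(x)` with the
  parametric integrals of Part 3, and OUTER integrability on `[0,1]`.
* Part 4 — `KernelsContinuous` dischargers: constant kernels and kernels continuous on all of `ℝ`/`ℝ²` satisfy the per-atom
  condition, and `ClosedForm.KernelsContinuous` unfolds along `[]`/`::`/`++` — the bookkeeping an instance's `cont_*` fields need.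

Typer: ls-knife-typer-3 g8 (cell landau-siegel §D; WAKE ls-lead g3 08:16:01Z (2); theory g3 08:19:15Z (A)/(C) boundary:
this file is E₀-free).

## References
* Y. Zhang, arXiv:2211.02515v1 (2022), §2 (2.32); §7 Prop. 7.1 (7.2); §8 (8.5), (8.11)–(8.12); §12 (12.7)–(12.8).
  [cite: Zhang2022LandauSiegel, §7 Prop 7.1 (7.2), §8 (8.5), (8.11)–(8.12), §12 (12.7)–(12.8)]
* G. B. Folland, *Real Analysis: Modern Techniques and Their Applications*, 2nd ed., Wiley (1999): Thm 1.21 (translation /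
  dilation invariance of Lebesgue measure, §1.5), Thm 2.27 (continuity of parameter integrals under domination, §2.3),
  Thm 3.35 (fundamental theorem of calculus for Lebesgue integrals, §3.5) — statements read on the page (lit store
  `book:follandnd-real-analysis`, chunks p0042 / p0060 / p0109). [cite: Folland1999, Thm 1.21, Thm 2.27, Thm 3.35]
-/

noncomputable section

open Complex Real ComplexConjugate Set MeasureTheory Filter
open scoped Topology Interval

namespace Literature.NumberTheory.LFunctions.Zhang2022

/-! ### Part 1 — the reflection `y ↦ 1 − y` on `[0,1]` -/

section Reflection

/-- `y ↦ 1 − y` preserves Lebesgue measure restricted to `(0,1]` (translation/reflection invariance of Lebesgue measure,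
`m(E + s) = m(E)`, `m(rE) = |r| m(E)` with `r = −1`, `s = 1`; the image `[0,1)` differs from `(0,1]` by null endpoints).
[cite: Folland1999, Thm 1.21] -/
theorem measurePreserving_one_sub_unitIoc :
    MeasurePreserving (fun y : ℝ => 1 - y) (volume.restrict (Ioc (0:ℝ) 1)) (volume.restrict (Ioc (0:ℝ) 1)) := by
  have h := (Measure.measurePreserving_sub_left (volume : Measure ℝ) (1:ℝ)).restrict_preimage
    (measurableSet_Ioc (a := (0:ℝ)) (b := 1))
  have hpre : (fun y : ℝ => 1 - y) ⁻¹' Ioc (0:ℝ) 1 = Ico 0 1 := by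
    ext y
    simp only [mem_preimage, mem_Ioc, mem_Ico]
    constructor <;> intro h <;> constructor <;> linarith [h.1, h.2]
  rw [hpre, Measure.restrict_congr_set Ico_ae_eq_Ioc] at h
  exact h

/-- An `Lᵖ` leg on `(0,1]` stays `Lᵖ` after the reflection `y ↦ 1 − y` (composition with a measure-preserving map).
[cite: Folland1999, Thm 1.21] -/
theorem memLp_comp_one_sub_unit {φ : ℝ → ℂ} {p : ENNReal} (hφ : MemLp φ p (volume.restrict (Ioc (0:ℝ) 1))) :
    MemLp (fun y => φ (1 - y)) p (volume.restrict (Ioc (0:ℝ) 1)) :=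
  hφ.comp_measurePreserving measurePreserving_one_sub_unitIoc

variable {g g' : ℝ → ℂ}

/-- **Reflection of an `H¹` profile.** If `g(y) = g(0) + ∫₀ʸ g′` on `[0,1]` with `g′ ∈ L²(0,1)`, then `y ↦ g(1−y)` is an
`H¹` profile with marked derivative `y ↦ −g′(1−y)`: `g(1−y) = g(1) + ∫₀ʸ (−g′(1−t)) dt`, by `∫₀ʸ g′(1−t) dt = ∫_{1−y}^{1} g′`.
(A kinked profile — RIGHT derivatives — reflects to one with LEFT derivatives; the `H¹` level is side-free and is all the
honest-integral lemmas use.) The fundamental theorem of calculus for Lebesgue integrals (absolutely continuous `F` ⟺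
`F(x) = F(a) + ∫ₐˣ f`, `f ∈ L¹`) transported along the reflection. [cite: Folland1999, Thm 3.35] -/
theorem IsH1OnUnitInterval.reflect (hg : IsH1OnUnitInterval g g') :
    IsH1OnUnitInterval (fun y => g (1 - y)) (fun y => -g' (1 - y)) where
  memLp := (memLp_comp_one_sub_unit hg.memLp).neg
  eq_add_integral := fun y hy => by
    have hy' : 1 - y ∈ Icc (0:ℝ) 1 := ⟨by linarith [hy.2], by linarith [hy.1]⟩
    have h1 := hg.eq_add_integral (1 - y) hy'
    have h2 := hg.eq_add_integral 1 ⟨zero_le_one, le_rfl⟩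
    have hint : IntervalIntegrable g' volume 0 1 := hg.intervalIntegrable
    have hadd := intervalIntegral.integral_add_adjacent_intervals (intervalIntegrable_mono_unit hint hy')
      (hint.mono_set (by
        rw [uIcc_of_le hy'.2, uIcc_of_le zero_le_one]
        exact Icc_subset_Icc_left hy'.1))
    have hsub : (∫ t in (0:ℝ)..y, -g' (1 - t)) = -∫ t in (1 - y)..1, g' t := by
      rw [intervalIntegral.integral_neg, intervalIntegral.integral_comp_sub_left (fun t => g' t) (1:ℝ)]
      norm_num
    simp only [sub_zero]
    rw [hsub, h1, h2, ← hadd]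
    ring

end Reflection

/-! ### Part 3 — parametric integrals against a kernel continuous on the closed square -/

section Parametric

variable {K : ℝ → ℝ → ℂ} {h : ℝ → ℂ}

/-- The `x`-section of a kernel continuous on the closed square `[0,1]²` (the side condition `KernelsContinuous` of the
two-variable atoms of (7.2)/(8.12)) is continuous on `[0,1]`. [cite: Zhang2022LandauSiegel, §7 Prop 7.1 (7.2)] -/
theorem continuousOn_kernel_section_left (hK : ContinuousOn (Function.uncurry K) (Icc 0 1 ×ˢ Icc 0 1))
    {x : ℝ} (hx : x ∈ Icc (0:ℝ) 1) : ContinuousOn (fun y => K x y) (Icc 0 1) :=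
  hK.comp (continuousOn_const.prodMk continuousOn_id) fun _ hy => ⟨hx, hy⟩

/-- The `y`-section of a kernel continuous on the closed square `[0,1]²` is continuous on `[0,1]`.
[cite: Zhang2022LandauSiegel, §7 Prop 7.1 (7.2)] -/
theorem continuousOn_kernel_section_right (hK : ContinuousOn (Function.uncurry K) (Icc 0 1 ×ˢ Icc 0 1))
    {y : ℝ} (hy : y ∈ Icc (0:ℝ) 1) : ContinuousOn (fun x => K x y) (Icc 0 1) :=
  hK.comp (continuousOn_id.prodMk continuousOn_const) fun _ hx => ⟨hx, hy⟩

/-- A kernel continuous on the closed (compact) square `[0,1]²` is bounded there — the dominating constant for the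
parametric integrals below. [cite: Zhang2022LandauSiegel, §7 Prop 7.1 (7.2)] -/
theorem exists_kernel_bound (hK : ContinuousOn (Function.uncurry K) (Icc 0 1 ×ˢ Icc 0 1)) :
    ∃ M : ℝ, ∀ x ∈ Icc (0:ℝ) 1, ∀ y ∈ Icc (0:ℝ) 1, ‖K x y‖ ≤ M := by
  obtain ⟨M, hM⟩ := (isCompact_Icc.prod isCompact_Icc).exists_bound_of_continuousOn hK
  exact ⟨M, fun x hx y hy => hM (x, y) ⟨hx, hy⟩⟩

/-- For `x ∈ [0,1]`, the section integrand `y ↦ K(x,y) h(y)` is integrable on `[0,1]` when `h` is (`C⁰·L¹`).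
[cite: Zhang2022LandauSiegel, §7 Prop 7.1 (7.2)] -/
theorem intervalIntegrable_kernel_section_mul (hK : ContinuousOn (Function.uncurry K) (Icc 0 1 ×ˢ Icc 0 1))
    (hh : IntervalIntegrable h volume 0 1) {x : ℝ} (hx : x ∈ Icc (0:ℝ) 1) :
    IntervalIntegrable (fun y => K x y * h y) volume 0 1 :=
  hh.continuousOn_mul (by rw [uIcc_of_le zero_le_one]; exact continuousOn_kernel_section_left hK hx)

/-- **Parametric integral against a kernel continuous on the closed square:** for `h ∈ L¹[0,1]`,
`x ↦ ∫₀¹ K(x,y) h(y) dy` is continuous on `[0,1]` — continuity of an integral depending on a parameter under an integrable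
dominating function (here `‖K‖_∞ |h|`), i.e. dominated convergence. [cite: Folland1999, Thm 2.27] -/
theorem continuousOn_parametric_integral_unit (hK : ContinuousOn (Function.uncurry K) (Icc 0 1 ×ˢ Icc 0 1))
    (hh : IntervalIntegrable h volume 0 1) :
    ContinuousOn (fun x => ∫ y in (0:ℝ)..1, K x y * h y) (Icc 0 1) := by
  obtain ⟨M, hM⟩ := exists_kernel_bound hK
  have hh' : IntegrableOn h (Ioc 0 1) volume := by
    have := hh.1; rwa [IntegrableOn] at this ⊢
  have hIoc : Ι (0:ℝ) 1 = Ioc 0 1 := uIoc_of_le zero_le_one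
  intro x₀ hx₀
  refine intervalIntegral.continuousWithinAt_of_dominated_interval (bound := fun y => M * ‖h y‖) ?_ ?_ ?_ ?_
  · filter_upwards [self_mem_nhdsWithin] with x hx
    rw [hIoc]
    exact (((continuousOn_kernel_section_left hK hx).mono Ioc_subset_Icc_self).aestronglyMeasurable
      measurableSet_Ioc).mul hh'.aestronglyMeasurable
  · filter_upwards [self_mem_nhdsWithin] with x hx
    refine ae_of_all _ fun y hy => ?_
    rw [hIoc] at hy
    rw [norm_mul]
    exact mul_le_mul_of_nonneg_right (hM x hx y (Ioc_subset_Icc_self hy)) (norm_nonneg _)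
  · exact hh.norm.const_mul M
  · refine ae_of_all _ fun y hy => ?_
    rw [hIoc] at hy
    exact ((continuousOn_kernel_section_right hK (Ioc_subset_Icc_self hy)) x₀ hx₀).mul continuousWithinAt_const

/-- **Volterra primitive against a kernel continuous on the closed square:** for `h ∈ L¹[0,1]`,
`x ↦ ∫₀ˣ K(x,y) h(y) dy` is continuous on `[0,1]` (on `[0,1]` it is `∫₀¹ 𝟙_{y ≤ x} K(x,y) h(y) dy`; dominated convergence,
the integrand being continuous in `x` at `x₀` for every `y ≠ x₀`, a null set). [cite: Folland1999, Thm 2.27] -/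
theorem continuousOn_parametric_primitive_unit (hK : ContinuousOn (Function.uncurry K) (Icc 0 1 ×ˢ Icc 0 1))
    (hh : IntervalIntegrable h volume 0 1) :
    ContinuousOn (fun x => ∫ y in (0:ℝ)..x, K x y * h y) (Icc 0 1) := by
  obtain ⟨M, hM⟩ := exists_kernel_bound hK
  have hh' : IntegrableOn h (Ioc 0 1) volume := by
    have := hh.1; rwa [IntegrableOn] at this ⊢
  have hIoc : Ι (0:ℝ) 1 = Ioc 0 1 := uIoc_of_le zero_le_one
  have key : EqOn (fun x => ∫ y in (0:ℝ)..x, K x y * h y)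
      (fun x => ∫ y in (0:ℝ)..1, indicator {y | y ≤ x} (fun y => K x y * h y) y) (Icc 0 1) :=
    fun x hx => (intervalIntegral.integral_indicator hx).symm
  refine ContinuousOn.congr ?_ key
  intro x₀ hx₀
  refine intervalIntegral.continuousWithinAt_of_dominated_interval (bound := fun y => M * ‖h y‖) ?_ ?_ ?_ ?_
  · filter_upwards [self_mem_nhdsWithin] with x hx
    rw [hIoc]
    exact ((((continuousOn_kernel_section_left hK hx).mono Ioc_subset_Icc_self).aestronglyMeasurable
      measurableSet_Ioc).mul hh'.aestronglyMeasurable).indicator measurableSet_Iic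
  · filter_upwards [self_mem_nhdsWithin] with x hx
    refine ae_of_all _ fun y hy => ?_
    rw [hIoc] at hy
    refine (norm_indicator_le_norm_self _ _).trans ?_
    rw [norm_mul]
    exact mul_le_mul_of_nonneg_right (hM x hx y (Ioc_subset_Icc_self hy)) (norm_nonneg _)
  · exact hh.norm.const_mul M
  · have hae : ∀ᵐ y ∂(volume : Measure ℝ), y ≠ x₀ := by
      rw [ae_iff]
      simp only [ne_eq, not_not, setOf_eq_eq_singleton, Real.volume_singleton]
    filter_upwards [hae] with y hy hyI
    rw [hIoc] at hyI
    have hcont : ContinuousWithinAt (fun x => K x y * h y) (Icc 0 1) x₀ :=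
      ((continuousOn_kernel_section_right hK (Ioc_subset_Icc_self hyI)) x₀ hx₀).mul continuousWithinAt_const
    rcases lt_or_gt_of_ne hy with hlt | hgt
    · -- `y < x₀`: near `x₀` the indicator is on
      have hev : ∀ᶠ x in 𝓝[Icc (0:ℝ) 1] x₀,
          indicator {y' | y' ≤ x} (fun y' => K x y' * h y') y = K x y * h y := by
        filter_upwards [mem_nhdsWithin_of_mem_nhds (Ioi_mem_nhds hlt)] with x hx
        exact indicator_of_mem (by simp only [mem_setOf_eq]; exact le_of_lt (mem_Ioi.1 hx)) _
      exact hcont.congr_of_eventuallyEq hev (indicator_of_mem (by simp only [mem_setOf_eq]; exact le_of_lt hlt) _)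
    · -- `y > x₀`: near `x₀` the indicator is off
      have hev : ∀ᶠ x in 𝓝[Icc (0:ℝ) 1] x₀,
          indicator {y' | y' ≤ x} (fun y' => K x y' * h y') y = (0:ℂ) := by
        filter_upwards [mem_nhdsWithin_of_mem_nhds (Iio_mem_nhds hgt)] with x hx
        exact indicator_of_notMem (by simp only [mem_setOf_eq, not_le]; exact mem_Iio.1 hx) _
      exact (continuousWithinAt_const (b := (0:ℂ))).congr_of_eventuallyEq hev
        (indicator_of_notMem (by simp only [mem_setOf_eq, not_le]; exact hgt) _)

end Parametric

namespace KnifeEdge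

open Repair Skeleton

/-! ### Part 2 — honest integral for the reflected atom `antiloc` -/

section Antiloc

/-- **Honest integral (pin (b″)) for the reflected-point atom `antiloc`:** with kernels continuous on `[0,1]` and kinked
legs the integrand of `antilocalPair k₀₀ k₀₁ k₁₀ k₁₁` — `k₀₀(y)f(y)ḡ(1−y) + k₀₁ f(y)ḡ′(1−y) + k₁₀ f′(y)ḡ(1−y) +
k₁₁ f′(y)ḡ′(1−y)` — is integrable on `[0,1]` (`C⁰·C⁰`, `C⁰·L²`, `L²·L²`, the second leg reflected by
`IsH1OnUnitInterval.reflect`), so the interval integral is a value, not Lean's junk `0`.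
[cite: Zhang2022LandauSiegel, §7 Prop 7.1 (7.2), §12 (12.7)–(12.8)] -/
theorem intervalIntegrable_antilocalPair_integrand {k₀₀ k₀₁ k₁₀ k₁₁ : ℝ → ℂ} (h₀₀ : ContinuousOn k₀₀ (Icc 0 1))
    (h₀₁ : ContinuousOn k₀₁ (Icc 0 1)) (h₁₀ : ContinuousOn k₁₀ (Icc 0 1)) (h₁₁ : ContinuousOn k₁₁ (Icc 0 1))
    {f f' g g' : ℝ → ℂ} (hf : KinkedProfile f f') (hg : KinkedProfile g g') :
    IntervalIntegrable (fun y => k₀₀ y * f y * conj (g (1 - y)) + k₀₁ y * f y * conj (g' (1 - y)) +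
      k₁₀ y * f' y * conj (g (1 - y)) + k₁₁ y * f' y * conj (g' (1 - y))) MeasureTheory.volume 0 1 := by
  have hF := hf.isH1
  have hG := hg.isH1.reflect
  have hI : uIcc (0:ℝ) 1 = Icc 0 1 := uIcc_of_le zero_le_one
  have e₀₀ : IntervalIntegrable (fun y => k₀₀ y * (f y * conj (g (1 - y)))) MeasureTheory.volume 0 1 :=
    (hF.intervalIntegrable_mul_conj hG).continuousOn_mul (by rw [hI]; exact h₀₀)
  have e₀₁ : IntervalIntegrable (fun y => k₀₁ y * (conj (-g' (1 - y)) * f y)) MeasureTheory.volume 0 1 := by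
    refine IntervalIntegrable.continuousOn_mul ?_ (by rw [hI]; exact h₀₁)
    have := hG.intervalIntegrable_deriv_mul_conj hF
    have hc : IntervalIntegrable (fun y => conj (-g' (1 - y) * conj (f y))) MeasureTheory.volume 0 1 := by
      rw [intervalIntegrable_iff] at this ⊢
      exact (Complex.conjLIE.toContinuousLinearMap.integrable_comp this : _)
    refine hc.congr ?_
    intro y _
    simp [map_mul]
  have e₁₀ : IntervalIntegrable (fun y => k₁₀ y * (f' y * conj (g (1 - y)))) MeasureTheory.volume 0 1 :=
    (hF.intervalIntegrable_deriv_mul_conj hG).continuousOn_mul (by rw [hI]; exact h₁₀)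
  have e₁₁ : IntervalIntegrable (fun y => k₁₁ y * (f' y * conj (-g' (1 - y)))) MeasureTheory.volume 0 1 :=
    (hF.intervalIntegrable_deriv_mul_conj_deriv hG).continuousOn_mul (by rw [hI]; exact h₁₁)
  have hsum := ((e₀₀.sub e₀₁).add e₁₀).sub e₁₁
  refine hsum.congr ?_
  intro y _
  simp only [map_neg]
  ring

/-- With an honest integrand the `antiloc` atom is literally that integral: its value on kinked legs unfolds with no side
condition left. [cite: Zhang2022LandauSiegel, §7 Prop 7.1 (7.2)] -/
theorem ClosedFormAtom.eval_antiloc_apply (k₀₀ k₀₁ k₁₀ k₁₁ : ℝ → ℂ) (f f' g g' : ℝ → ℂ) :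
    (ClosedFormAtom.antiloc k₀₀ k₀₁ k₁₀ k₁₁).eval f f' g g' =
      ∫ y in (0:ℝ)..1, (k₀₀ y * f y * conj (g (1 - y)) + k₀₁ y * f y * conj (g' (1 - y)) +
        k₁₀ y * f' y * conj (g (1 - y)) + k₁₁ y * f' y * conj (g' (1 - y))) := rfl

end Antiloc

/-! ### Part 4 — `KernelsContinuous` dischargers and the list bookkeeping of `ClosedForm.KernelsContinuous` -/

section KernelsContinuous

namespace ClosedFormAtom

/-- Everywhere-continuous one-variable kernels discharge `(loc …).KernelsContinuous`. [cite: Zhang2022LandauSiegel, §7 Prop 7.1 (7.2)] -/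
theorem kernelsContinuous_loc {k₀₀ k₀₁ k₁₀ k₁₁ : ℝ → ℂ} (h₀₀ : Continuous k₀₀) (h₀₁ : Continuous k₀₁)
    (h₁₀ : Continuous k₁₀) (h₁₁ : Continuous k₁₁) : (loc k₀₀ k₀₁ k₁₀ k₁₁).KernelsContinuous :=
  ⟨h₀₀.continuousOn, h₀₁.continuousOn, h₁₀.continuousOn, h₁₁.continuousOn⟩

/-- Everywhere-continuous one-variable kernels discharge `(antiloc …).KernelsContinuous`. [cite: Zhang2022LandauSiegel, §7 Prop 7.1 (7.2)] -/
theorem kernelsContinuous_antiloc {k₀₀ k₀₁ k₁₀ k₁₁ : ℝ → ℂ} (h₀₀ : Continuous k₀₀) (h₀₁ : Continuous k₀₁)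
    (h₁₀ : Continuous k₁₀) (h₁₁ : Continuous k₁₁) : (antiloc k₀₀ k₀₁ k₁₀ k₁₁).KernelsContinuous :=
  ⟨h₀₀.continuousOn, h₀₁.continuousOn, h₁₀.continuousOn, h₁₁.continuousOn⟩

/-- Everywhere-continuous two-variable kernels discharge `(bulk …).KernelsContinuous`. [cite: Zhang2022LandauSiegel, §7 Prop 7.1 (7.2)] -/
theorem kernelsContinuous_bulk {K₀₀ K₀₁ K₁₀ K₁₁ : ℝ → ℝ → ℂ} (h₀₀ : Continuous (Function.uncurry K₀₀))
    (h₀₁ : Continuous (Function.uncurry K₀₁)) (h₁₀ : Continuous (Function.uncurry K₁₀))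
    (h₁₁ : Continuous (Function.uncurry K₁₁)) : (bulk K₀₀ K₀₁ K₁₀ K₁₁).KernelsContinuous :=
  ⟨h₀₀.continuousOn, h₀₁.continuousOn, h₁₀.continuousOn, h₁₁.continuousOn⟩

/-- Everywhere-continuous two-variable kernels discharge `(volt …).KernelsContinuous`. [cite: Zhang2022LandauSiegel, §7 Prop 7.1 (7.2)] -/
theorem kernelsContinuous_volt {K₀₀ K₀₁ K₁₀ K₁₁ : ℝ → ℝ → ℂ} (h₀₀ : Continuous (Function.uncurry K₀₀))
    (h₀₁ : Continuous (Function.uncurry K₀₁)) (h₁₀ : Continuous (Function.uncurry K₁₀))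
    (h₁₁ : Continuous (Function.uncurry K₁₁)) : (volt K₀₀ K₀₁ K₁₀ K₁₁).KernelsContinuous :=
  ⟨h₀₀.continuousOn, h₀₁.continuousOn, h₁₀.continuousOn, h₁₁.continuousOn⟩

/-- Everywhere-continuous kernels and a marked point in `[0,1]` discharge `(intPt …).KernelsContinuous`.
[cite: Zhang2022LandauSiegel, §7 Prop 7.1 (7.2)] -/
theorem kernelsContinuous_intPt {k₀ k₁ : ℝ → ℂ} {y₀ : ℝ} (h₀ : Continuous k₀) (h₁ : Continuous k₁)
    (hy₀ : y₀ ∈ Icc (0:ℝ) 1) : (intPt k₀ k₁ y₀).KernelsContinuous :=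
  ⟨h₀.continuousOn, h₁.continuousOn, hy₀⟩

/-- A marked point in `[0,1]` and everywhere-continuous kernels discharge `(ptInt …).KernelsContinuous`.
[cite: Zhang2022LandauSiegel, §7 Prop 7.1 (7.2)] -/
theorem kernelsContinuous_ptInt {x₀ : ℝ} {k₀ k₁ : ℝ → ℂ} (hx₀ : x₀ ∈ Icc (0:ℝ) 1) (h₀ : Continuous k₀)
    (h₁ : Continuous k₁) : (ptInt x₀ k₀ k₁).KernelsContinuous :=
  ⟨hx₀, h₀.continuousOn, h₁.continuousOn⟩

/-- Two marked points in `[0,1]` discharge `(ptPt …).KernelsContinuous`. [cite: Zhang2022LandauSiegel, §7 Prop 7.1 (7.2)] -/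
theorem kernelsContinuous_ptPt (w : ℂ) {x₀ y₀ : ℝ} (hx₀ : x₀ ∈ Icc (0:ℝ) 1) (hy₀ : y₀ ∈ Icc (0:ℝ) 1) :
    (ptPt w x₀ y₀).KernelsContinuous :=
  ⟨hx₀, hy₀⟩

/-- Constant one-variable kernels: `(loc c₀₀ c₀₁ c₁₀ c₁₁).KernelsContinuous`. [cite: Zhang2022LandauSiegel, §7 Prop 7.1 (7.2)] -/
theorem kernelsContinuous_loc_const (c₀₀ c₀₁ c₁₀ c₁₁ : ℂ) :
    (loc (fun _ => c₀₀) (fun _ => c₀₁) (fun _ => c₁₀) (fun _ => c₁₁)).KernelsContinuous :=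
  kernelsContinuous_loc continuous_const continuous_const continuous_const continuous_const

/-- Constant two-variable kernels: `(bulk …).KernelsContinuous`. [cite: Zhang2022LandauSiegel, §7 Prop 7.1 (7.2)] -/
theorem kernelsContinuous_bulk_const (c₀₀ c₀₁ c₁₀ c₁₁ : ℂ) :
    (bulk (fun _ _ => c₀₀) (fun _ _ => c₀₁) (fun _ _ => c₁₀) (fun _ _ => c₁₁)).KernelsContinuous :=
  kernelsContinuous_bulk continuous_const continuous_const continuous_const continuous_const

/-- Constant two-variable kernels: `(volt …).KernelsContinuous`. [cite: Zhang2022LandauSiegel, §7 Prop 7.1 (7.2)] -/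
theorem kernelsContinuous_volt_const (c₀₀ c₀₁ c₁₀ c₁₁ : ℂ) :
    (volt (fun _ _ => c₀₀) (fun _ _ => c₀₁) (fun _ _ => c₁₀) (fun _ _ => c₁₁)).KernelsContinuous :=
  kernelsContinuous_volt continuous_const continuous_const continuous_const continuous_const

end ClosedFormAtom

/-- The empty closed form has continuous kernels. [cite: Zhang2022LandauSiegel, §7 Prop 7.1 (7.2)] -/
@[simp] theorem ClosedForm.kernelsContinuous_nil : ClosedForm.KernelsContinuous [] := by
  simp [ClosedForm.KernelsContinuous]

/-- `KernelsContinuous` along `::`. [cite: Zhang2022LandauSiegel, §7 Prop 7.1 (7.2)] -/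
@[simp] theorem ClosedForm.kernelsContinuous_cons {a : ClosedFormAtom} {L : ClosedForm} :
    ClosedForm.KernelsContinuous (a :: L) ↔ a.KernelsContinuous ∧ ClosedForm.KernelsContinuous L := by
  simp [ClosedForm.KernelsContinuous]

/-- `KernelsContinuous` along `++`. [cite: Zhang2022LandauSiegel, §7 Prop 7.1 (7.2)] -/
@[simp] theorem ClosedForm.kernelsContinuous_append {L₁ L₂ : ClosedForm} :
    ClosedForm.KernelsContinuous (L₁ ++ L₂) ↔ ClosedForm.KernelsContinuous L₁ ∧ ClosedForm.KernelsContinuous L₂ := by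
  simp only [ClosedForm.KernelsContinuous, List.mem_append]
  exact ⟨fun h => ⟨fun a ha => h a (Or.inl ha), fun a ha => h a (Or.inr ha)⟩,
    fun h a ha => ha.elim (h.1 a) (h.2 a)⟩

/-- Building a `cont_*` field atom by atom. [cite: Zhang2022LandauSiegel, §7 Prop 7.1 (7.2)] -/
theorem ClosedForm.KernelsContinuous.cons {a : ClosedFormAtom} {L : ClosedForm} (ha : a.KernelsContinuous)
    (hL : ClosedForm.KernelsContinuous L) : ClosedForm.KernelsContinuous (a :: L) :=
  ClosedForm.kernelsContinuous_cons.2 ⟨ha, hL⟩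

/-- `eval` along `++` (assembling a table from per-degree / per-term pieces). [cite: Zhang2022LandauSiegel, §7 Prop 7.1 (7.2)] -/
theorem ClosedForm.eval_append : ∀ L₁ L₂ : ClosedForm, ClosedForm.eval (L₁ ++ L₂) = ClosedForm.eval L₁ + ClosedForm.eval L₂
  | [], L₂ => by simp
  | a :: L₁, L₂ => by rw [List.cons_append, ClosedForm.eval_cons, ClosedForm.eval_cons, ClosedForm.eval_append L₁ L₂, add_assoc]

end KernelsContinuous

end KnifeEdge

end Literature.NumberTheory.LFunctions.Zhang2022

end
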